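import Summits.CriticalPhenomena.PercolationContinuityZ3.Theorems.PercTorusSliceFillingTorusNonProliferationBK
import Literature.Barriers.CriticalPhenomena.KozmaNachmiasLocalBad
import Literature.Probability.Percolation.CriticalContinuityProofs
import HarnessLib

/-!
# `TorusNonProliferation`: the BK reduction, asymptotic form (route `PercTorusSliceFilling`,
# crux stmt-CriticalPhenomena-5415)

Support file (`--supports stmt-CriticalPhenomena-5415`). The landed BK reduction
`torusNonProliferation_of_noSliceFilling_pos` (file `PercTorusSliceFillingTorusNonProliferationBK`)
derives the crux from `∃ c > 0, ∀ n ≥ 3, P_{T_n,p_c}(no slice-filling cluster) ≥ c`. Here the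
hypothesis is weakened to its natural ASYMPTOTIC form — a positive `liminf`:
`∃ c > 0, ∃ N, ∀ n ≥ N, P_{T_n,p_c}(no slice-filling cluster) ≥ c` — the finitely many tori
`3 ≤ n < N` being handled by the trivial positivity `P_{T_n,p_c}(no sf cluster) ≥ P(all edges
closed) > 0` (`0 < p_c(ℤ³) < 1`, tree: `criticalProb_zd_pos`, `criticalProb_zd_lt_one`, and the
cylinder positivity `Literature.Barriers.CriticalPhenomena.real_localCylinder_pos`; in the all-closed
configuration every cluster is a singleton, which misses a slice as soon as `n ≥ 2`).
-/

noncomputable section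

namespace Summit.CriticalPhenomena.PercolationContinuityZ3.Theorems

open MeasureTheory Set
open Literature.Probability.Percolation Literature.Probability.LatticeModels

namespace PercTorusSliceFillingTorusNonProliferationBK

/-- In the all-closed configuration no cluster of `T_n`, `n ≥ 2`, is slice-filling (clusters are
singletons and `ZMod n` has two distinct elements). [folklore] -/
theorem empty_mem_noSliceFilling (n : ℕ) (hn : 2 ≤ n) :
    (∅ : BondConfig (TorusSite 3 n)) ∈ {ω : BondConfig (TorusSite 3 n) |
      ∀ x : TorusSite 3 n, ¬ ∃ i : Fin 3, ∀ t : ZMod n, ∃ y ∈ openCluster ω x, y i = t} := by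
  intro x ⟨i, hi⟩
  haveI : Fact (1 < n) := ⟨by omega⟩
  obtain ⟨y, hy, hyt⟩ := hi (x i + 1)
  -- in the empty configuration the cluster of `x` is `{x}`
  have hyx : y = x := by
    have hr : (openGraph (∅ : BondConfig (TorusSite 3 n))).Reachable x y := hy
    obtain ⟨w⟩ := hr
    cases w with
    | nil => rfl
    | cons hadj _ =>
      exact absurd ((openGraph_adj _ _ _).1 hadj).1 (Set.notMem_empty _)
  rw [hyx] at hyt
  exact absurd hyt.symm (by simp)

/-- For every `n ≥ 2` the critical torus has no slice-filling cluster with POSITIVE probability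
(at least the mass of the all-closed configuration, `0 < p_c(ℤ³) < 1`). [folklore] -/
theorem real_noSliceFilling_pos (n : ℕ) (hn : 2 ≤ n) :
    0 < (bondPercolation (torusGraph 3 n) (criticalProbI 3)).real
      {ω : BondConfig (TorusSite 3 n) |
        ∀ x : TorusSite 3 n, ¬ ∃ i : Fin 3, ∀ t : ZMod n, ∃ y ∈ openCluster ω x, y i = t} := by
  classical
  haveI : NeZero n := ⟨by omega⟩
  have hp0 : 0 < ((criticalProbI 3 : unitInterval) : ℝ) := by
    rw [coe_criticalProbI]; exact criticalProb_zd_pos 3 (by norm_num)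
  have hp1 : ((criticalProbI 3 : unitInterval) : ℝ) < 1 := by
    rw [coe_criticalProbI]; exact criticalProb_zd_lt_one (by norm_num)
  have hcyl : 0 < (bondPercolation (torusGraph 3 n) (criticalProbI 3)).real
      (localCylinder ↑(Finset.univ : Finset (Sym2 (TorusSite 3 n))) (∅ : BondConfig (TorusSite 3 n))) :=
    Literature.Barriers.CriticalPhenomena.real_localCylinder_pos (torusGraph 3 n) hp0 hp1
      Finset.univ (Set.empty_subset _)
  refine hcyl.trans_le (measureReal_mono ?_)
  intro ω hω
  have hωe : ω = ∅ := by
    ext e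
    simpa using hω e (Finset.mem_coe.2 (Finset.mem_univ e))
  rw [hωe]
  exact empty_mem_noSliceFilling n hn

end PercTorusSliceFillingTorusNonProliferationBK

open PercTorusSliceFillingTorusNonProliferationBK

/-- **BK reduction of `TorusNonProliferation`, asymptotic form.** If
`liminf_n P_{T_n,p_c}(no open cluster of T_n is slice-filling) > 0` — precisely
`∃ c > 0, ∃ N, ∀ n ≥ N, P_{T_n,p_c}(∀ x, C(x) not sf) ≥ c` (NOT proved; the torus form of
"critical crossing probabilities stay bounded away from one", open in `d = 3`) — then the number of
slice-filling clusters of the critical 3-torus is tight. The tori `3 ≤ n < N` have no sf cluster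
with positive probability (`real_noSliceFilling_pos`), so the uniform hypothesis of
`torusNonProliferation_of_noSliceFilling_pos` holds with the minimum of finitely many positive
numbers. [folklore] -/
theorem torusNonProliferation_of_noSliceFilling_eventually_pos : (∃ c : ℝ, 0 < c ∧ ∃ N : ℕ, ∀ n : ℕ, N ≤ n → c ≤ (Literature.Probability.Percolation.bondPercolation (Literature.Probability.LatticeModels.torusGraph 3 n) (Literature.Probability.Percolation.criticalProbI 3)).real {ω | ∀ x : Literature.Probability.LatticeModels.TorusSite 3 n, ¬ ∃ i : Fin 3, ∀ t : ZMod n, ∃ y ∈ Literature.Probability.Percolation.openCluster ω x, y i = t}) → Summit.CriticalPhenomena.PercolationContinuityZ3.Theses.PercTorusSliceFilling.TorusNonProliferation := by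
  classical
  rintro ⟨c, hc, N, hN⟩
  -- `f n = P_{T_n,p_c}(no sf cluster)`, `g n = min c (f n)` for `n ≥ 2` and `c` otherwise
  set f : ℕ → ℝ := fun n => (bondPercolation (torusGraph 3 n) (criticalProbI 3)).real
    {ω : BondConfig (TorusSite 3 n) |
      ∀ x : TorusSite 3 n, ¬ ∃ i : Fin 3, ∀ t : ZMod n, ∃ y ∈ openCluster ω x, y i = t} with hf
  set g : ℕ → ℝ := fun n => if 2 ≤ n then min c (f n) else c with hg
  have hgpos : ∀ n, 0 < g n := by
    intro n
    simp only [hg]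
    split_ifs with h2
    · exact lt_min hc (real_noSliceFilling_pos n h2)
    · exact hc
  have hgc : ∀ n, g n ≤ c := by
    intro n
    simp only [hg]
    split_ifs
    · exact min_le_left _ _
    · exact le_rfl
  have hgf : ∀ n, 2 ≤ n → g n ≤ f n := by
    intro n h2
    simp only [hg, if_pos h2]
    exact min_le_right _ _
  -- the uniform constant: the minimum of `g` over `{0, …, N}`
  set T : Finset ℕ := insert N (Finset.range N) with hT
  have hTne : T.Nonempty := ⟨N, Finset.mem_insert_self _ _⟩
  set c' : ℝ := T.inf' hTne g with hc'
  have hc'pos : 0 < c' := (Finset.lt_inf'_iff hTne).2 fun n _ => hgpos n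
  have hc'le : ∀ n ∈ T, c' ≤ g n := fun n hn => Finset.inf'_le g hn
  refine torusNonProliferation_of_noSliceFilling_pos ⟨c', hc'pos, fun n hn => ?_⟩
  show c' ≤ f n
  by_cases hnN : N ≤ n
  · calc c' ≤ g N := hc'le N (Finset.mem_insert_self _ _)
      _ ≤ c := hgc N
      _ ≤ f n := hN n hnN
  · have hmem : n ∈ T := Finset.mem_insert_of_mem (Finset.mem_range.2 (Nat.lt_of_not_le hnN))
    exact (hc'le n hmem).trans (hgf n (by omega))

end Summit.CriticalPhenomena.PercolationContinuityZ3.Theorems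

end
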